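import Literature.Computability.Cryptography.LWEDecisionToSearchSpec
import Literature.Computability.Cryptography.LWESampleCodes
import Literature.Computability.Complexity.FoldCatBricks
import HarnessLib

/-!
# Regev's decision-to-search reduction for LWE, III: the query generator is polynomial time

Topic `Computability/Cryptography` (LWE), grouping namespace `LWE.DecisionToSearch`, continuing
part I (`LWEDecisionToSearchSpec.lean`: the queries `Params.qry S b` of the reduction as functions
of the input tuple `S`) and `LWESampleCodes.lean` (the code `encodeLWESamples` field by field). The
oracle machine of `regev_decision_to_search` (`LWEHardness.lean`) is the truth-table transducer
`ttFnAlgL Q X G` of `TruthTableTransducers.lean`; this file builds its **query generator**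

  `queryFn pR pN pB : {0,1}* → {0,1}*`,  `queryFn ⟨⟨encodeLWESamples S, r⟩, 1ᵇ⟩ = encodeLWESamples (Params.qry S b)`

for every query index `b < N + G·N` (`queryFn_spec`; the parameters `R = pR(n)`, `N = pN(n)`,
`B = pB(n)` are fixed polynomials in the dimension, read off the input in unary), and proves
`queryFn_mem_FP`. No machine is programmed: `queryFn` is a pipeline of the tree's `FP` bricks —

* parsing (`BrickAlgebra` projections): `n`, `q`, `m'` from the self-describing header, `1ⁿ` from
  the first sample; the unary parameters `1^R, 1^N, 1^B, 1^K, 1^m` (`Plumb.polyFn`, `HashBricks.umulFn`,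
  `OracleCompose.concatFn`, `Plumb.divModFn`: `m = m'/2K`);
* the query index `1ᵇ ↦` (uniform query `b < N`) or (test query: group `g = (b-N)/N`, repetition
  `j = (b-N) mod N`, then `r = g mod R`, `k = (g/R) mod B`, `i = (g/R)/B`), all by `divModFn`;
* the two halves of the unit of the query as coded lists (`Brick.dropLF` with binary counters
  `Brick.lenBinF`), zipped by `Brick.zipLF` with the item function: for a uniform query
  `(code x, code x') ↦ code (a, (a')₀)` (pure plumbing), for a test query
  `(code x, code x') ↦ code (f_t (c_{i,k,l} x))`, `l = (a')₀` — one `Brick.setNthLF` (coordinate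
  `i` of `a` becomes `aᵢ + l mod q`) and one `Brick.zipFoldLF` (the inner product `⟨a', t⟩ mod q`
  accumulated onto `b + l k mod q`, arithmetic by `Brick.addFn`/`prodFn`/`remFn`), the shift
  vector `t = t_r` being the residue list of sample `0` of unit `r` (`Brick.nthLF`); item outputs are
  clipped to `9(|z|+1)²` symbols (`Brick.pclipF` of `FoldCatBricks.lean`, harmless on intended inputs by `length_lweSampleCode_le`)
  so that the loop bodies have the polynomial growth the list bricks require on EVERY input.

## References

* O. Regev, *On lattices, learning with errors, random linear codes, and cryptography*, J. ACM 56
  (2009), §4, proofs of Lemmas 4.1–4.2 (the transformations applied to the samples before each call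
  of `W`). [cite: RegevLWE2009, §4 Lemma 4.1–4.2]
* S. Arora, B. Barak, *Computational Complexity: A Modern Approach*, CUP 2009, §1.3 (polynomial
  time is closed under composition and polynomially bounded loops). [cite: AroraBarak2009, §1.3]
-/

noncomputable section

namespace Literature.Computability.Cryptography

namespace LWE

namespace DecisionToSearch

open _root_.Computability Polynomial Complexity Complexity.Brick Complexity.Plumb Complexity.OracleCompose
  Complexity.HashBricks

variable {n q m : ℕ}

/-! ### Generic helpers -/

/-- Modular bookkeeping for `b + l·k`. [folklore] -/
theorem mod_add_mul_mod (b s k q : ℕ) : (b + s * (k % q) % q) % q = (b + s * k) % q := by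
  rw [Nat.add_mod_mod, Nat.add_mod, Nat.mul_mod, Nat.mod_mod, ← Nat.mul_mod, ← Nat.add_mod]

/-- Quotient and remainder of `a·b + c` by `b` for `c < b`. [folklore] -/
theorem mul_add_div_mod {a b c : ℕ} (hb : 0 < b) (hc : c < b) : (a * b + c) / b = a ∧ (a * b + c) % b = c := by
  constructor
  · rw [Nat.add_comm, Nat.add_mul_div_right _ _ hb, Nat.div_eq_of_lt hc, Nat.zero_add]
  · rw [Nat.add_comm, Nat.add_mul_mod_self_right, Nat.mod_eq_of_lt hc]

/-! ### The intended inputs -/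

/-- The machine input for sample tuple `S`, second register `r` (coins; empty for the reduction) and
query index `b`: `⟨⟨encodeLWESamples S, r⟩, 1ᵇ⟩`. [folklore] -/
def zIn (S : Fin m → (Fin n → ZMod q) × ZMod q) (r : List Bool) (b : ℕ) : List Bool :=
  boolPair (boolPair (encodeLWESamples S) r) (ones b)

/-! ### Parsing the header and the unary parameters -/

/-- The sample code `x`. [folklore] -/
def xF : List Bool → List Bool := fstF ∘ fstF
/-- The query index `1ᵇ`. [folklore] -/
def jF : List Bool → List Bool := sndF
/-- `bin n`. [folklore] -/
def hnF : List Bool → List Bool := fstF ∘ xF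
/-- `bin q`. [folklore] -/
def hqF : List Bool → List Bool := nthF 1 ∘ xF
/-- `1^{m'}`. [folklore] -/
def ummF : List Bool → List Bool := nthF 2 ∘ xF
/-- The coded list of the `m'` sample codes. [folklore] -/
def itemsF : List Bool → List Bool := sndPow 2 ∘ xF
/-- `1ⁿ`, read off the first sample. [folklore] -/
def unF : List Bool → List Bool := fstF ∘ fstF ∘ fstF ∘ itemsF

section Params

variable (pR pN pB : Polynomial ℕ)

/-- `1^R`. [folklore] -/
noncomputable def uRF : List Bool → List Bool := polyFn pR ∘ unF
/-- `1^N`. [folklore] -/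
noncomputable def uNF : List Bool → List Bool := polyFn pN ∘ unF
/-- `1^B`. [folklore] -/
noncomputable def uBF : List Bool → List Bool := polyFn pB ∘ unF
/-- `1^G`, `G = n·B·R`. [folklore] -/
noncomputable def uGF : List Bool → List Bool := umulFn ∘ fanoutFn (umulFn ∘ fanoutFn unF (uBF pB)) (uRF pR)
/-- `1^K`, `K = R + (N + G·N)`. [folklore] -/
noncomputable def uKF : List Bool → List Bool :=
  concatFn ∘ fanoutFn (uRF pR) (concatFn ∘ fanoutFn (uNF pN) (umulFn ∘ fanoutFn (uGF pR pB) (uNF pN)))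
/-- `1^{2K}`. [folklore] -/
noncomputable def u2KF : List Bool → List Bool := concatFn ∘ fanoutFn (uKF pR pN pB) (uKF pR pN pB)
/-- `1ᵐ`, `m = m'/2K`. [folklore] -/
noncomputable def umF : List Bool → List Bool := fstF ∘ divModFn ∘ fanoutFn (u2KF pR pN pB) ummF
/-- `1^{2m}`. [folklore] -/
noncomputable def u2mF : List Bool → List Bool := concatFn ∘ fanoutFn (umF pR pN pB) (umF pR pN pB)

/-! ### Decoding the query index -/

/-- The bit `[b < N]` (uniform query?). [folklore] -/
noncomputable def isUF : List Bool → List Bool := ltLenF ∘ fanoutFn jF (uNF pN)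
/-- `1^{b-N}`. [folklore] -/
noncomputable def jxF : List Bool → List Bool := dropFn ∘ fanoutFn (uNF pN) jF
/-- `⟨1^g, 1^j⟩`, `g = (b-N)/N`, `j = (b-N) mod N`. [folklore] -/
noncomputable def gjF : List Bool → List Bool := divModFn ∘ fanoutFn (uNF pN) (jxF pN)
/-- `1^g`. [folklore] -/
noncomputable def gF : List Bool → List Bool := fstF ∘ gjF pN
/-- `1^j` (test query). [folklore] -/
noncomputable def jjF : List Bool → List Bool := sndF ∘ gjF pN
/-- `⟨1^{g/R}, 1^{g mod R}⟩`. [folklore] -/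
noncomputable def ikrF : List Bool → List Bool := divModFn ∘ fanoutFn (uRF pR) (gF pN)
/-- `1^r`, `r = g mod R`. [folklore] -/
noncomputable def rF : List Bool → List Bool := sndF ∘ ikrF pR pN
/-- `⟨1^i, 1^k⟩`, `i = (g/R)/B`, `k = (g/R) mod B`. [folklore] -/
noncomputable def ik2F : List Bool → List Bool := divModFn ∘ fanoutFn (uBF pB) (fstF ∘ ikrF pR pN)
/-- `1^i`. [folklore] -/
noncomputable def iF : List Bool → List Bool := fstF ∘ ik2F pR pN pB
/-- `1^k`. [folklore] -/
noncomputable def kF : List Bool → List Bool := sndF ∘ ik2F pR pN pB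
/-- The unit of a uniform query: `1^{R + b}`. [folklore] -/
noncomputable def unitUF : List Bool → List Bool := concatFn ∘ fanoutFn (uRF pR) jF
/-- The unit of a test query: `1^{R + (N + (g·N + j))}`. [folklore] -/
noncomputable def unitXF : List Bool → List Bool :=
  concatFn ∘ fanoutFn (uRF pR) (concatFn ∘ fanoutFn (uNF pN) (concatFn ∘ fanoutFn (umulFn ∘ fanoutFn (gF pN) (uNF pN)) (jjF pN)))

/-! ### The coded lists of the two halves of a unit -/

/-- The list of sample codes from a given position on: `⟨1ᵖ ↦ items.drop p⟩`, as a function of the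
input and a unary position selector `pos`. [folklore] -/
noncomputable def fromF (pos : List Bool → List Bool) : List Bool → List Bool :=
  dropLF ∘ fanoutFn id (fanoutFn (lenBinF ∘ pos) itemsF)

/-- The first sample of a unit, as a position: `unit · 2m`. [folklore] -/
noncomputable def startF (unit : List Bool → List Bool) : List Bool → List Bool :=
  umulFn ∘ fanoutFn unit (u2mF pR pN pB)

/-- The first sample of the second half of a unit: `unit · 2m + m`. [folklore] -/
noncomputable def midF (unit : List Bool → List Bool) : List Bool → List Bool :=
  concatFn ∘ fanoutFn (startF pR pN pB unit) (umF pR pN pB)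

/-- The residue code of the shift vector `t_r`: the `a`-part of sample `r·2m`. [folklore] -/
noncomputable def tResF : List Bool → List Bool :=
  sndF ∘ fstF ∘ nthLF ∘ fanoutFn id (fanoutFn (lenBinF ∘ startF pR pN pB (rF pR pN)) itemsF)

end Params

/-! ### Values on the intended inputs -/

section Values

variable (S : Fin m → (Fin n → ZMod q) × ZMod q) (r : List Bool) (b : ℕ)

/-- Parsing: the sample code. [folklore] -/
@[simp] theorem xF_zIn : xF (zIn S r b) = encodeLWESamples S := by simp [xF, zIn]
/-- Parsing: the query index. [folklore] -/
@[simp] theorem jF_zIn : jF (zIn S r b) = ones b := by simp [jF, zIn]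
/-- Parsing: `bin n`. [folklore] -/
@[simp] theorem hnF_zIn : hnF (zIn S r b) = encodeNat n := by simp [hnF, encodeLWESamples_eq]
/-- Parsing: `bin q`. [folklore] -/
@[simp] theorem hqF_zIn : hqF (zIn S r b) = encodeNat q := by simp [hqF, encodeLWESamples_eq]
/-- Parsing: `1^{m'}`. [folklore] -/
@[simp] theorem ummF_zIn : ummF (zIn S r b) = ones m := by simp [ummF, encodeLWESamples_eq]
/-- Parsing: the items. [folklore] -/
@[simp] theorem itemsF_zIn : itemsF (zIn S r b) = lweBlockCode S := by simp [itemsF, encodeLWESamples_eq]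

/-- Parsing: `1ⁿ` (nonempty tuple). [folklore] -/
theorem unF_zIn (hm : 0 < m) : unF (zIn S r b) = ones n := by
  simp only [unF, Function.comp_apply, itemsF_zIn, fstF_lweBlockCode hm, fstF_fstF_lweSampleCode]

end Values

section ParamValues

variable (pR pN pB : Polynomial ℕ) (D : ℕ)

/-- The parameters of the reduction at dimension `n`, for polynomial parameter functions:
`R = pR(n)`, `N = pN(n)`, `B = pB(n)` (and the advantage parameter `D`, unused by the machine). [folklore] -/
def PP (n : ℕ) : Params := ⟨pR.eval n, pN.eval n, pB.eval n, D⟩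

/-- `(PP n).R = pR(n)`. [folklore] -/
@[simp] theorem PP_R (n : ℕ) : (PP pR pN pB D n).R = pR.eval n := rfl
/-- `(PP n).N = pN(n)`. [folklore] -/
@[simp] theorem PP_N (n : ℕ) : (PP pR pN pB D n).N = pN.eval n := rfl
/-- `(PP n).B = pB(n)`. [folklore] -/
@[simp] theorem PP_B (n : ℕ) : (PP pR pN pB D n).B = pB.eval n := rfl
/-- `(PP n).D = D`. [folklore] -/
@[simp] theorem PP_D (n : ℕ) : (PP pR pN pB D n).D = D := rfl

variable (S : Fin ((PP pR pN pB D n).total n m) → (Fin n → ZMod q) × ZMod q) (r : List Bool) (b : ℕ)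

/-- A nonempty input has positive `K` and `m`. [folklore] -/
theorem pos_of_total_pos {P : Params} (htot : 0 < P.total n m) : 0 < P.K n ∧ 0 < m := by
  unfold Params.total at htot
  rcases Nat.eq_zero_or_pos (P.K n) with h | h
  · simp [h] at htot
  rcases Nat.eq_zero_or_pos m with h' | h'
  · simp [h'] at htot
  exact ⟨h, h'⟩

/-- `1^R`. [folklore] -/
theorem uRF_zIn (htot : 0 < (PP pR pN pB D n).total n m) : uRF pR (zIn S r b) = ones (pR.eval n) := by
  simp [uRF, unF_zIn S r b htot]

/-- `1^N`. [folklore] -/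
theorem uNF_zIn (htot : 0 < (PP pR pN pB D n).total n m) : uNF pN (zIn S r b) = ones (pN.eval n) := by
  simp [uNF, unF_zIn S r b htot]

/-- `1^B`. [folklore] -/
theorem uBF_zIn (htot : 0 < (PP pR pN pB D n).total n m) : uBF pB (zIn S r b) = ones (pB.eval n) := by
  simp [uBF, unF_zIn S r b htot]

/-- `1^G`. [folklore] -/
theorem uGF_zIn (htot : 0 < (PP pR pN pB D n).total n m) : uGF pR pB (zIn S r b) = ones ((PP pR pN pB D n).groups n) := by
  simp [uGF, umulFn_apply, uRF_zIn pR pN pB D S r b htot, uBF_zIn pR pN pB D S r b htot, unF_zIn S r b htot, Params.groups]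

/-- `1^K`. [folklore] -/
theorem uKF_zIn (htot : 0 < (PP pR pN pB D n).total n m) : uKF pR pN pB (zIn S r b) = ones ((PP pR pN pB D n).K n) := by
  simp [uKF, umulFn_apply, uRF_zIn pR pN pB D S r b htot, uNF_zIn pR pN pB D S r b htot, uGF_zIn pR pN pB D S r b htot,
    Params.K]

/-- `1ᵐ` (`m'/2K = m` since `m' = K·2m` and `K > 0`). [folklore] -/
theorem umF_zIn (htot : 0 < (PP pR pN pB D n).total n m) : umF pR pN pB (zIn S r b) = ones m := by
  have hK : 0 < (PP pR pN pB D n).K n := (pos_of_total_pos htot).1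
  simp only [umF, u2KF, Function.comp_apply, fanoutFn_apply, uKF_zIn pR pN pB D S r b htot, concatFn_boolPair,
    Com.ones_append, ummF_zIn, divModFn_boolPair, fstF_boolPair]
  congr 1
  rw [show (PP pR pN pB D n).K n + (PP pR pN pB D n).K n = 2 * (PP pR pN pB D n).K n by ring,
    show (PP pR pN pB D n).total n m = (2 * (PP pR pN pB D n).K n) * m by unfold Params.total; ring,
    Nat.mul_div_cancel_left _ (by omega)]

/-- `1^{2m}`. [folklore] -/
theorem u2mF_zIn (htot : 0 < (PP pR pN pB D n).total n m) : u2mF pR pN pB (zIn S r b) = ones (m + m) := by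
  simp [u2mF, umF_zIn pR pN pB D S r b htot]

/-- The branch bit. [folklore] -/
theorem isUF_zIn (htot : 0 < (PP pR pN pB D n).total n m) : isUF pN (zIn S r b) = [decide (b < pN.eval n)] := by
  simp [isUF, uNF_zIn pR pN pB D S r b htot]

/-- The unit of a uniform query. [folklore] -/
theorem unitUF_zIn (htot : 0 < (PP pR pN pB D n).total n m) : unitUF pR (zIn S r b) = ones (pR.eval n + b) := by
  simp [unitUF, uRF_zIn pR pN pB D S r b htot]

/-- Decoding a test index: the group and the repetition. [folklore] -/
theorem gjF_zIn_x (htot : 0 < (PP pR pN pB D n).total n m) (g : Fin ((PP pR pN pB D n).groups n)) (j : Fin (pN.eval n)) :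
    gF pN (zIn S r ((PP pR pN pB D n).xIdx g.val j.val)) = ones g.val ∧
      jjF pN (zIn S r ((PP pR pN pB D n).xIdx g.val j.val)) = ones j.val := by
  have hNpos : 0 < pN.eval n := lt_of_le_of_lt (Nat.zero_le _) j.isLt
  have e : gjF pN (zIn S r ((PP pR pN pB D n).xIdx g.val j.val)) = boolPair (ones g.val) (ones j.val) := by
    rw [gjF, jxF, Function.comp_apply, fanoutFn_apply, Function.comp_apply, fanoutFn_apply,
      uNF_zIn pR pN pB D S r _ htot, jF_zIn, dropFn_boolPair, List.length_replicate, Params.xIdx, PP_N, List.drop_replicate,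
      Nat.add_sub_cancel_left, divModFn_boolPair, Nat.add_comm, Nat.add_mul_div_right _ _ hNpos, Nat.div_eq_of_lt j.isLt,
      Nat.zero_add, Nat.add_mul_mod_self_right, Nat.mod_eq_of_lt j.isLt]
  exact ⟨by rw [gF, Function.comp_apply, e, fstF_boolPair], by rw [jjF, Function.comp_apply, e, sndF_boolPair]⟩

/-- Decoding a test index: the triple `(i, k, r)` of the group. [folklore] -/
theorem ikrF_zIn_x (htot : 0 < (PP pR pN pB D n).total n m) (i : Fin n) (k : Fin (pB.eval n)) (r' : Fin (pR.eval n))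
    (j : Fin (pN.eval n)) :
    rF pR pN (zIn S r ((PP pR pN pB D n).xIdx ((PP pR pN pB D n).gOf i k r').val j.val)) = ones r'.val ∧
      iF pR pN pB (zIn S r ((PP pR pN pB D n).xIdx ((PP pR pN pB D n).gOf i k r').val j.val)) = ones i.val ∧
      kF pR pN pB (zIn S r ((PP pR pN pB D n).xIdx ((PP pR pN pB D n).gOf i k r').val j.val)) = ones k.val := by
  have hRpos : 0 < pR.eval n := lt_of_le_of_lt (Nat.zero_le _) r'.isLt
  have hBpos : 0 < pB.eval n := lt_of_le_of_lt (Nat.zero_le _) k.isLt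
  have hg := (gjF_zIn_x pR pN pB D S r htot ((PP pR pN pB D n).gOf i k r') j).1
  have e1 : ikrF pR pN (zIn S r ((PP pR pN pB D n).xIdx ((PP pR pN pB D n).gOf i k r').val j.val)) =
      boolPair (ones (i.val * pB.eval n + k.val)) (ones r'.val) := by
    rw [ikrF, Function.comp_apply, fanoutFn_apply, uRF_zIn pR pN pB D S r _ htot, hg, divModFn_boolPair, Params.val_gOf]
    simp only [PP_R, PP_B]
    obtain ⟨h1, h2⟩ := mul_add_div_mod (a := i.val * pB.eval n + k.val) hRpos r'.isLt
    rw [h1, h2]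
  have e2 : ik2F pR pN pB (zIn S r ((PP pR pN pB D n).xIdx ((PP pR pN pB D n).gOf i k r').val j.val)) =
      boolPair (ones i.val) (ones k.val) := by
    rw [ik2F, Function.comp_apply, fanoutFn_apply, Function.comp_apply, uBF_zIn pR pN pB D S r _ htot, e1, fstF_boolPair,
      divModFn_boolPair]
    obtain ⟨h1, h2⟩ := mul_add_div_mod (a := i.val) hBpos k.isLt
    rw [h1, h2]
  exact ⟨by rw [rF, Function.comp_apply, e1, sndF_boolPair], by rw [iF, Function.comp_apply, e2, fstF_boolPair],
    by rw [kF, Function.comp_apply, e2, sndF_boolPair]⟩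

end ParamValues
/-! ### The item functions -/

section Items

/-- The code of the scalar of a sample is the first residue of its residue code (also in dimension
`0`, where both are empty). [folklore] -/
theorem encodeNat_scal_val (x : (Fin n → ZMod q) × ZMod q) : encodeNat (scal x).val = fstF (lweResidueCode x.1) := by
  rcases Nat.eq_zero_or_pos n with hn | hn
  · subst hn
    rw [lweResidueCode_of_eq_zero rfl, Brick.fstF_nil, scal, dif_neg (lt_irrefl 0), ZMod.val_zero]
    rfl
  · rw [scal_eq hn, fstF_lweResidueCode hn]

/-- **The uniform item function**: `⟨z, ⟨prm, ⟨code x, code x'⟩⟩⟩ ↦ code (a, (a')₀)` — the `a`-part of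
the first code paired with the first residue of the second. [cite: RegevLWE2009, §4 (proof of Lemma 4.1)] -/
noncomputable def fUnifF : List Bool → List Bool :=
  fanoutFn (fstF ∘ nthF 2) (fstF ∘ sndF ∘ fstF ∘ sndPow 2)

/-- Value of `fUnifF` on a record. [folklore] -/
theorem fUnifF_record (z prm A B : List Bool) :
    fUnifF (boolPair z (boolPair prm (boolPair A B))) = boolPair (fstF A) (fstF (sndF (fstF B))) := by
  simp [fUnifF]

/-- **`fUnifF` on two sample codes is the code of the uniform-block sample.** [folklore] -/
theorem fUnifF_codes (z prm : List Bool) (x x' : (Fin n → ZMod q) × ZMod q) :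
    fUnifF (boolPair z (boolPair prm (boolPair (lweSampleCode x) (lweSampleCode x')))) = lweSampleCode (x.1, scal x') := by
  rw [fUnifF_record, sndF_fstF_lweSampleCode, ← encodeNat_scal_val]
  simp [lweSampleCode]

/-- Growth of `fUnifF`: `≤ 2(|a| + |b|) + 2` on every record. [folklore] -/
theorem length_fUnifF_le (x p a b : List Bool) :
    (fUnifF (boolPair x (boolPair p (boolPair a b)))).length ≤ 2 * (a.length + b.length) + (2 : Polynomial ℕ).eval x.length := by
  rw [fUnifF_record, length_boolPair]
  have h1 := length_fstF_sndF_le a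
  have h2 := length_fstF_sndF_le b
  have h3 := length_fstF_sndF_le (fstF b)
  have h4 := length_fstF_sndF_le (sndF (fstF b))
  simp only [eval_ofNat]
  omega

/-- `fUnifF ∈ FP`. [folklore] -/
theorem fUnifF_mem_FP : fUnifF ∈ FP :=
  fanoutFn_mem_FP (comp_mem_FP fstF_mem_FP (nthF_mem_FP 2))
    (comp_mem_FP fstF_mem_FP (comp_mem_FP sndF_mem_FP (comp_mem_FP fstF_mem_FP (sndPow_mem_FP 2))))

/-- **The inner-product step**: `⟨z, ⟨bin q, ⟨u, ⟨v, acc⟩⟩⟩⟩ ↦ bin ((⟦acc⟧ + ⟦u⟧⟦v⟧) mod q)`.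
[cite: RegevLWE2009, §4 (proof of Lemma 4.1: the shift `f_t`)] -/
noncomputable def fdotF : List Bool → List Bool :=
  remFn ∘ fanoutFn (addFn ∘ fanoutFn (sndPow 3) (prodFn ∘ fanoutFn (nthF 2) (nthF 3))) (nthF 1)

/-- Value of `fdotF` on a record. [folklore] -/
theorem fdotF_record (z Qc u v acc : List Bool) :
    fdotF (boolPair z (boolPair Qc (boolPair u (boolPair v acc)))) =
      encodeNat ((bitsToNat acc + bitsToNat u * bitsToNat v) % bitsToNat Qc) := by
  simp [fdotF]

/-- Growth of `fdotF`: `≤ |acc| + (|u| + |v|) + 1` on every record. [folklore] -/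
theorem length_fdotF_le (x p a b acc : List Bool) :
    (fdotF (boolPair x (boolPair p (boolPair a (boolPair b acc))))).length ≤
      acc.length + 2 * (a.length + b.length) + (1 : Polynomial ℕ).eval x.length := by
  rw [fdotF_record, eval_one]
  have h1 : (encodeNat ((bitsToNat acc + bitsToNat a * bitsToNat b) % bitsToNat p)).length ≤
      (encodeNat (bitsToNat acc + bitsToNat a * bitsToNat b)).length := length_encodeNat_mono (Nat.mod_le _ _)
  have h2 := length_encodeNat_add_le acc (encodeNat (bitsToNat a * bitsToNat b))
  rw [bitsToNat_encodeNat] at h2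
  have h3 := length_encodeNat_mul_le a b
  omega

/-- `fdotF ∈ FP`. [folklore] -/
theorem fdotF_mem_FP : fdotF ∈ FP :=
  comp_mem_FP remFn_mem_FP (fanoutFn_mem_FP (comp_mem_FP addFn_mem_FP (fanoutFn_mem_FP (sndPow_mem_FP 3)
    (comp_mem_FP prodFn_mem_FP (fanoutFn_mem_FP (nthF_mem_FP 2) (nthF_mem_FP 3))))) (nthF_mem_FP 1))

/-- **The inner product by a fold**: folding `fdotF` over the zipped residue codes of `u` and `v` from
`bin c` gives `bin (c + ⟨u, v⟩)` (all in `ℤ_q`). [cite: RegevLWE2009, §4 (proof of Lemma 4.1)] -/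
theorem foldl_fdotF [NeZero q] (z : List Bool) : ∀ (l : List (ZMod q × ZMod q)) (c : ZMod q),
    (l.map fun uv => (encodeNat uv.1.val, encodeNat uv.2.val)).foldl
        (fun acc ab => fdotF (boolPair z (boolPair (encodeNat q) (boolPair ab.1 (boolPair ab.2 acc))))) (encodeNat c.val) =
      encodeNat (c + (l.map fun uv => uv.1 * uv.2).sum).val
  | [], c => by simp
  | uv :: l, c => by
    rw [List.map_cons, List.foldl_cons, fdotF_record, bitsToNat_encodeNat, bitsToNat_encodeNat, bitsToNat_encodeNat,
      bitsToNat_encodeNat, show (c.val + uv.1.val * uv.2.val) % q = (c + uv.1 * uv.2).val by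
        rw [ZMod.val_add, ZMod.val_mul, Nat.add_mod_mod],
      foldl_fdotF z l (c + uv.1 * uv.2), List.map_cons, List.sum_cons, add_assoc]

/-- The zipped residue codes of two vectors. [folklore] -/
theorem zip_residueList (u v : Fin n → ZMod q) :
    List.zip (residueList u) (residueList v) =
      (List.ofFn fun i => (u i, v i)).map fun uv => (encodeNat uv.1.val, encodeNat uv.2.val) := by
  apply List.ext_getElem
  · simp [residueList]
  · intro i h1 h2
    simp [residueList]

/-- The dot product as the sum over the list of coordinate pairs. [folklore] -/
theorem dotProduct_eq_sum_ofFn (u v : Fin n → ZMod q) :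
    u ⬝ᵥ v = ((List.ofFn fun i => (u i, v i)).map fun uv => uv.1 * uv.2).sum := by
  rw [dotProduct, List.map_ofFn, List.sum_ofFn]
  rfl

/-- The residue list of a coordinate update is the updated residue list. [folklore] -/
theorem residueList_add_single [NeZero q] (a : Fin n → ZMod q) (i : Fin n) (l : ZMod q) :
    residueList (a + Pi.single i l) = (residueList a).set i.val (encodeNat (a i + l).val) := by
  apply List.ext_getElem
  · simp
  · intro j h1 h2
    rw [getElem_residueList]
    by_cases hij : j = i.val
    · subst hij
      rw [List.getElem_set_self]
      simp
    · rw [List.getElem_set_ne (Ne.symm hij), getElem_residueList]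
      have : (⟨j, by simpa using h1⟩ : Fin n) ≠ i := fun h => hij (by rw [← h])
      simp [this]

variable (Pc : Polynomial ℕ)

/-- Accessors of the test item function on `w = ⟨z, ⟨⟨bin q, ⟨1ⁱ, ⟨bin k, code t⟩⟩⟩, ⟨code x, code x'⟩⟩⟩`:
the modulus. [folklore] -/
def qcW : List Bool → List Bool := fstF ∘ nthF 1
/-- … the coordinate `1ⁱ`. [folklore] -/
def uiW : List Bool → List Bool := nthF 1 ∘ nthF 1
/-- … the guess `bin k`. [folklore] -/
def kcW : List Bool → List Bool := nthF 2 ∘ nthF 1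
/-- … the residue code of `t`. [folklore] -/
def tcW : List Bool → List Bool := sndPow 2 ∘ nthF 1
/-- … `1ⁿ` from the first code. [folklore] -/
def unW : List Bool → List Bool := fstF ∘ fstF ∘ nthF 2
/-- … the residue code of `a`. [folklore] -/
def resW : List Bool → List Bool := sndF ∘ fstF ∘ nthF 2
/-- … `bin b`. [folklore] -/
def bcW : List Bool → List Bool := sndF ∘ nthF 2
/-- … `bin l`, `l = (a')₀`. [folklore] -/
def lcW : List Bool → List Bool := fstF ∘ sndF ∘ fstF ∘ sndPow 2
/-- `bin aᵢ`. [folklore] -/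
noncomputable def aiOldW : List Bool → List Bool := nthLF ∘ fanoutFn (nthF 0) (fanoutFn (lenBinF ∘ uiW) resW)
/-- `bin (aᵢ + l mod q)`. [folklore] -/
noncomputable def aiNewW : List Bool → List Bool := remFn ∘ fanoutFn (addFn ∘ fanoutFn aiOldW lcW) qcW
/-- The residue code of `a' = a + l eᵢ`. [folklore] -/
noncomputable def resNewW : List Bool → List Bool :=
  setNthLF ∘ fanoutFn (nthF 0) (fanoutFn (lenBinF ∘ uiW) (fanoutFn aiNewW resW))
/-- `bin (b + l k mod q)`. [folklore] -/
noncomputable def b0W : List Bool → List Bool := remFn ∘ fanoutFn (addFn ∘ fanoutFn bcW (prodFn ∘ fanoutFn lcW kcW)) qcW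
/-- `bin (b + l k + ⟨a', t⟩ mod q)`. [folklore] -/
noncomputable def bNewW : List Bool → List Bool :=
  zipFoldLF fdotF ∘ fanoutFn (nthF 0) (fanoutFn (lenBinF ∘ unW) (fanoutFn qcW (fanoutFn resNewW (fanoutFn tcW b0W))))
/-- **The test item function, unclipped**: `⟨z, ⟨⟨bin q, ⟨1ⁱ, ⟨bin k, code t⟩⟩⟩, ⟨code x, code x'⟩⟩⟩ ↦
code (f_t (c_{i,k,l} x))`, `l = (a')₀`. [cite: RegevLWE2009, §4 (proofs of Lemmas 4.1–4.2)] -/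
noncomputable def fXcore : List Bool → List Bool := fanoutFn (fanoutFn unW resNewW) bNewW
/-- **The test item function**, clipped to `Pc(|z|)` symbols. [folklore] -/
noncomputable def fX : List Bool → List Bool := pclipF Pc fXcore

/-- The intended argument record of the test item function. [folklore] -/
def wX (z : List Bool) (q' : ℕ) (i k : ℕ) (t : Fin n → ZMod q) (x x' : (Fin n → ZMod q) × ZMod q) : List Bool :=
  boolPair z (boolPair (boolPair (encodeNat q') (boolPair (ones i) (boolPair (encodeNat k) (lweResidueCode t))))
    (boolPair (lweSampleCode x) (lweSampleCode x')))

section XValues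

variable [NeZero q] (z : List Bool) (i : Fin n) (k : ℕ) (t : Fin n → ZMod q) (x x' : (Fin n → ZMod q) × ZMod q)

omit [NeZero q] in
/-- Reading the accessors on the intended record. [folklore] -/
theorem accessors_wX :
    qcW (wX z q i.val k t x x') = encodeNat q ∧ uiW (wX z q i.val k t x x') = ones i.val ∧
      kcW (wX z q i.val k t x x') = encodeNat k ∧ tcW (wX z q i.val k t x x') = lweResidueCode t ∧
      unW (wX z q i.val k t x x') = ones n ∧ resW (wX z q i.val k t x x') = lweResidueCode x.1 ∧
      bcW (wX z q i.val k t x x') = encodeNat x.2.val ∧ lcW (wX z q i.val k t x x') = encodeNat (scal x').val ∧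
      nthF 0 (wX z q i.val k t x x') = z := by
  simp [qcW, uiW, kcW, tcW, unW, resW, bcW, lcW, wX, encodeNat_scal_val]

omit [NeZero q] in
/-- `aiOldW = bin aᵢ` (`i ≤ |z|`). [folklore] -/
theorem aiOldW_wX (hz : n ≤ z.length) : aiOldW (wX z q i.val k t x x') = encodeNat (x.1 i).val := by
  obtain ⟨h1, h2, -, -, -, h6, -, -, h9⟩ := accessors_wX z i k t x x'
  rw [aiOldW, Function.comp_apply, fanoutFn_apply, fanoutFn_apply, Function.comp_apply, h9, h2, h6, lenBinF_apply,
    List.length_replicate, lweResidueCode_eq, nthLF_apply z (by omega), List.getD_eq_getElem _ _ (by simp),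
    getElem_residueList]

/-- `aiNewW = bin (aᵢ + l)`. [folklore] -/
theorem aiNewW_wX (hz : n ≤ z.length) : aiNewW (wX z q i.val k t x x') = encodeNat (x.1 i + scal x').val := by
  obtain ⟨h1, -, -, -, -, -, -, h8, -⟩ := accessors_wX z i k t x x'
  rw [aiNewW, Function.comp_apply, fanoutFn_apply, Function.comp_apply, fanoutFn_apply, aiOldW_wX z i k t x x' hz, h8, h1,
    remFn_boolPair, addFn_boolPair, bitsToNat_encodeNat, bitsToNat_encodeNat, bitsToNat_encodeNat, bitsToNat_encodeNat,
    ZMod.val_add]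

/-- `resNewW = code (a + l eᵢ)` (`n ≤ |z|`). [folklore] -/
theorem resNewW_wX (hz : n ≤ z.length) : resNewW (wX z q i.val k t x x') = lweResidueCode (x.1 + Pi.single i (scal x')) := by
  obtain ⟨-, h2, -, -, -, h6, -, -, h9⟩ := accessors_wX z i k t x x'
  rw [resNewW, Function.comp_apply, fanoutFn_apply, fanoutFn_apply, fanoutFn_apply, Function.comp_apply, h9, h2, h6,
    aiNewW_wX z i k t x x' hz, lenBinF_apply, List.length_replicate, lweResidueCode_eq, lweResidueCode_eq,
    setNthLF_apply z (by omega) _ (by simp), residueList_add_single]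

/-- `b0W = bin (b + l k)`. [folklore] -/
theorem b0W_wX : b0W (wX z q i.val k t x x') = encodeNat (x.2 + scal x' * (k : ZMod q)).val := by
  obtain ⟨h1, -, h3, -, -, -, h7, h8, -⟩ := accessors_wX z i k t x x'
  rw [b0W, Function.comp_apply, fanoutFn_apply, Function.comp_apply, fanoutFn_apply, Function.comp_apply, fanoutFn_apply,
    h7, h8, h3, h1, prodFn_boolPair, addFn_boolPair, remFn_boolPair]
  simp only [bitsToNat_encodeNat]
  rw [ZMod.val_add, ZMod.val_mul, ZMod.val_natCast, mod_add_mul_mod]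

/-- `bNewW = bin (b + l k + ⟨a', t⟩)` (`n ≤ |z|`). [folklore] -/
theorem bNewW_wX (hz : n ≤ z.length) :
    bNewW (wX z q i.val k t x x') =
      encodeNat (x.2 + scal x' * (k : ZMod q) + (x.1 + Pi.single i (scal x')) ⬝ᵥ t).val := by
  obtain ⟨h1, -, -, h4, h5, -, -, -, h9⟩ := accessors_wX z i k t x x'
  rw [bNewW, Function.comp_apply]
  simp only [fanoutFn_apply, Function.comp_apply]
  rw [h9, h5, h1, h4, resNewW_wX z i k t x x' hz, b0W_wX z i k t x x', lenBinF_apply, List.length_replicate,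
    lweResidueCode_eq, lweResidueCode_eq, zipFoldLF_apply fdotF z _ hz, List.take_of_length_le (by simp),
    List.take_of_length_le (by simp), zipFoldValue, zip_residueList, foldl_fdotF, ← dotProduct_eq_sum_ofFn]

/-- **`fXcore` computes the code of the transformed sample.** [cite: RegevLWE2009, §4 (proofs of Lemmas 4.1–4.2)] -/
theorem fXcore_wX (hz : n ≤ z.length) :
    fXcore (wX z q i.val k t x x') = lweSampleCode (shiftSample t (coordSample i (k : ZMod q) (scal x') x)) := by
  obtain ⟨-, -, -, -, h5, -, -, -, -⟩ := accessors_wX z i k t x x'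
  rw [fXcore, fanoutFn_apply, fanoutFn_apply, h5, resNewW_wX z i k t x x' hz, bNewW_wX z i k t x x' hz]
  obtain ⟨a, b⟩ := x
  simp only [coordSample_apply, shiftSample_apply, lweSampleCode]

/-- **`fX` computes the code of the transformed sample** when the clip allows a sample code
(`sampleCodeBound n q ≤ Pc(|z|)`). [folklore] -/
theorem fX_wX (hz : n ≤ z.length) (hP : sampleCodeBound n q ≤ Pc.eval z.length) :
    fX Pc (wX z q i.val k t x x') = lweSampleCode (shiftSample t (coordSample i (k : ZMod q) (scal x') x)) := by
  rw [fX, pclipF_eq_self, fXcore_wX z i k t x x' hz]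
  rw [fXcore_wX z i k t x x' hz, show fstF (wX z q i.val k t x x') = z by simp [wX]]
  exact (length_lweSampleCode_le _).trans hP

end XValues

/-- Growth of `fX`: `≤ Pc(|x|)` on every record (the clip). [folklore] -/
theorem length_fX_le (x p a b : List Bool) :
    (fX Pc (boolPair x (boolPair p (boolPair a b)))).length ≤ 0 * (a.length + b.length) + Pc.eval x.length := by
  rw [zero_mul, zero_add, fX]
  have h := length_pclipF_le Pc fXcore (boolPair x (boolPair p (boolPair a b)))
  rwa [fstF_boolPair] at h

/-- `fXcore ∈ FP`. [folklore] -/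
theorem fXcore_mem_FP : fXcore ∈ FP := by
  have hq : qcW ∈ FP := comp_mem_FP fstF_mem_FP (nthF_mem_FP 1)
  have hui : uiW ∈ FP := comp_mem_FP (nthF_mem_FP 1) (nthF_mem_FP 1)
  have hk : kcW ∈ FP := comp_mem_FP (nthF_mem_FP 2) (nthF_mem_FP 1)
  have ht : tcW ∈ FP := comp_mem_FP (sndPow_mem_FP 2) (nthF_mem_FP 1)
  have hun : unW ∈ FP := comp_mem_FP fstF_mem_FP (comp_mem_FP fstF_mem_FP (nthF_mem_FP 2))
  have hres : resW ∈ FP := comp_mem_FP sndF_mem_FP (comp_mem_FP fstF_mem_FP (nthF_mem_FP 2))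
  have hb : bcW ∈ FP := comp_mem_FP sndF_mem_FP (nthF_mem_FP 2)
  have hl : lcW ∈ FP := comp_mem_FP fstF_mem_FP (comp_mem_FP sndF_mem_FP (comp_mem_FP fstF_mem_FP (sndPow_mem_FP 2)))
  have hold : aiOldW ∈ FP :=
    comp_mem_FP nthLF_mem_FP (fanoutFn_mem_FP (nthF_mem_FP 0) (fanoutFn_mem_FP (comp_mem_FP lenBinF_mem_FP hui) hres))
  have hnew : aiNewW ∈ FP :=
    comp_mem_FP remFn_mem_FP (fanoutFn_mem_FP (comp_mem_FP addFn_mem_FP (fanoutFn_mem_FP hold hl)) hq)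
  have hresNew : resNewW ∈ FP :=
    comp_mem_FP setNthLF_mem_FP (fanoutFn_mem_FP (nthF_mem_FP 0) (fanoutFn_mem_FP (comp_mem_FP lenBinF_mem_FP hui)
      (fanoutFn_mem_FP hnew hres)))
  have hb0 : b0W ∈ FP :=
    comp_mem_FP remFn_mem_FP (fanoutFn_mem_FP (comp_mem_FP addFn_mem_FP (fanoutFn_mem_FP hb
      (comp_mem_FP prodFn_mem_FP (fanoutFn_mem_FP hl hk)))) hq)
  have hbNew : bNewW ∈ FP :=
    comp_mem_FP (zipFoldLF_mem_FP fdotF_mem_FP length_fdotF_le) (fanoutFn_mem_FP (nthF_mem_FP 0)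
      (fanoutFn_mem_FP (comp_mem_FP lenBinF_mem_FP hun) (fanoutFn_mem_FP hq (fanoutFn_mem_FP hresNew (fanoutFn_mem_FP ht hb0)))))
  exact fanoutFn_mem_FP (fanoutFn_mem_FP hun hresNew) hbNew

/-- `fX ∈ FP`. [folklore] -/
theorem fX_mem_FP : fX Pc ∈ FP := pclipF_mem_FP Pc fXcore_mem_FP

end Items

/-! ### The query generator -/

section Query

variable (pR pN pB Pc : Polynomial ℕ) (D : ℕ)

/-- The samples of the unit of a UNIFORM query, from its first sample on. [folklore] -/
noncomputable def l1UF : List Bool → List Bool := fromF (startF pR pN pB (unitUF pR))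
/-- … from the first sample of its second half on. [folklore] -/
noncomputable def l2UF : List Bool → List Bool := fromF (midF pR pN pB (unitUF pR))
/-- **The body of a uniform query**: the coded list of the `m` uniform-block sample codes. [cite: RegevLWE2009, §4 (proof of Lemma 4.1)] -/
noncomputable def bodyUF : List Bool → List Bool :=
  zipLF fUnifF ∘ fanoutFn id (fanoutFn (lenBinF ∘ umF pR pN pB) (fanoutFn (fun _ => []) (fanoutFn (l1UF pR pN pB) (l2UF pR pN pB))))
/-- The parameter record of a test query: `⟨bin q, ⟨1ⁱ, ⟨bin k, code t⟩⟩⟩`. [folklore] -/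
noncomputable def prmXF : List Bool → List Bool :=
  fanoutFn hqF (fanoutFn (iF pR pN pB) (fanoutFn (lenBinF ∘ kF pR pN pB) (tResF pR pN pB)))
/-- The samples of the unit of a TEST query, from its first sample on. [folklore] -/
noncomputable def l1XF : List Bool → List Bool := fromF (startF pR pN pB (unitXF pR pN))
/-- … from the first sample of its second half on. [folklore] -/
noncomputable def l2XF : List Bool → List Bool := fromF (midF pR pN pB (unitXF pR pN))
/-- **The body of a test query**: the coded list of the `m` transformed sample codes. [cite: RegevLWE2009, §4 (proofs of Lemmas 4.1–4.2)] -/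
noncomputable def bodyXF : List Bool → List Bool :=
  zipLF (fX Pc) ∘ fanoutFn id (fanoutFn (lenBinF ∘ umF pR pN pB) (fanoutFn (prmXF pR pN pB) (fanoutFn (l1XF pR pN pB) (l2XF pR pN pB))))
/-- **The query generator** of the reduction: `⟨bin n, ⟨bin q, ⟨1ᵐ, body⟩⟩⟩` with the uniform body
for `b < N` and the test body otherwise. [cite: RegevLWE2009, §4 Lemma 4.1–4.2] -/
noncomputable def queryFn : List Bool → List Bool :=
  fanoutFn hnF (fanoutFn hqF (fanoutFn (umF pR pN pB) (iteFn (isUF pN) (bodyUF pR pN pB) (bodyXF pR pN pB Pc))))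

/-! #### Polynomial time -/

/-- `fromF pos ∈ FP` for `pos ∈ FP`. [folklore] -/
theorem fromF_mem_FP {pos : List Bool → List Bool} (h : pos ∈ FP) : fromF pos ∈ FP :=
  comp_mem_FP dropLF_mem_FP (fanoutFn_mem_FP OracleCompose.id_mem_FP (fanoutFn_mem_FP (comp_mem_FP lenBinF_mem_FP h)
    (comp_mem_FP (sndPow_mem_FP 2) (comp_mem_FP fstF_mem_FP fstF_mem_FP))))

/-- The parsing functions are polynomial time. [folklore] -/
theorem parse_mem_FP : xF ∈ FP ∧ jF ∈ FP ∧ hnF ∈ FP ∧ hqF ∈ FP ∧ ummF ∈ FP ∧ itemsF ∈ FP ∧ unF ∈ FP := by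
  have hx : xF ∈ FP := comp_mem_FP fstF_mem_FP fstF_mem_FP
  have hit : itemsF ∈ FP := comp_mem_FP (sndPow_mem_FP 2) hx
  exact ⟨hx, sndF_mem_FP, comp_mem_FP fstF_mem_FP hx, comp_mem_FP (nthF_mem_FP 1) hx, comp_mem_FP (nthF_mem_FP 2) hx, hit,
    comp_mem_FP fstF_mem_FP (comp_mem_FP fstF_mem_FP (comp_mem_FP fstF_mem_FP hit))⟩

/-- The unary parameter functions are polynomial time. [folklore] -/
theorem params_mem_FP : uRF pR ∈ FP ∧ uNF pN ∈ FP ∧ uBF pB ∈ FP ∧ uGF pR pB ∈ FP ∧ uKF pR pN pB ∈ FP ∧ umF pR pN pB ∈ FP ∧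
    u2mF pR pN pB ∈ FP := by
  obtain ⟨-, -, -, -, humm, -, hun⟩ := parse_mem_FP
  have hR : uRF pR ∈ FP := comp_mem_FP (polyFn_mem_FP _) hun
  have hN : uNF pN ∈ FP := comp_mem_FP (polyFn_mem_FP _) hun
  have hB : uBF pB ∈ FP := comp_mem_FP (polyFn_mem_FP _) hun
  have hG : uGF pR pB ∈ FP := comp_mem_FP umulFn_mem_FP (fanoutFn_mem_FP (comp_mem_FP umulFn_mem_FP (fanoutFn_mem_FP hun hB)) hR)
  have hK : uKF pR pN pB ∈ FP := comp_mem_FP concatFn_mem_FP (fanoutFn_mem_FP hR (comp_mem_FP concatFn_mem_FP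
    (fanoutFn_mem_FP hN (comp_mem_FP umulFn_mem_FP (fanoutFn_mem_FP hG hN)))))
  have hm : umF pR pN pB ∈ FP := comp_mem_FP fstF_mem_FP (comp_mem_FP divModFn_mem_FP (fanoutFn_mem_FP
    (comp_mem_FP concatFn_mem_FP (fanoutFn_mem_FP hK hK)) humm))
  exact ⟨hR, hN, hB, hG, hK, hm, comp_mem_FP concatFn_mem_FP (fanoutFn_mem_FP hm hm)⟩

/-- The index-decoding functions are polynomial time. [folklore] -/
theorem index_mem_FP : isUF pN ∈ FP ∧ gF pN ∈ FP ∧ jjF pN ∈ FP ∧ rF pR pN ∈ FP ∧ iF pR pN pB ∈ FP ∧ kF pR pN pB ∈ FP ∧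
    unitUF pR ∈ FP ∧ unitXF pR pN ∈ FP := by
  obtain ⟨hR, hN, hB, -, -, -, -⟩ := params_mem_FP pR pN pB
  have hj : jF ∈ FP := sndF_mem_FP
  have hgj : gjF pN ∈ FP := comp_mem_FP divModFn_mem_FP (fanoutFn_mem_FP hN (comp_mem_FP dropFn_mem_FP (fanoutFn_mem_FP hN hj)))
  have hg : gF pN ∈ FP := comp_mem_FP fstF_mem_FP hgj
  have hjj : jjF pN ∈ FP := comp_mem_FP sndF_mem_FP hgj
  have hikr : ikrF pR pN ∈ FP := comp_mem_FP divModFn_mem_FP (fanoutFn_mem_FP hR hg)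
  have hik2 : ik2F pR pN pB ∈ FP := comp_mem_FP divModFn_mem_FP (fanoutFn_mem_FP hB (comp_mem_FP fstF_mem_FP hikr))
  exact ⟨comp_mem_FP ltLenF_mem_FP (fanoutFn_mem_FP hj hN), hg, hjj, comp_mem_FP sndF_mem_FP hikr, comp_mem_FP fstF_mem_FP hik2,
    comp_mem_FP sndF_mem_FP hik2, comp_mem_FP concatFn_mem_FP (fanoutFn_mem_FP hR hj),
    comp_mem_FP concatFn_mem_FP (fanoutFn_mem_FP hR (comp_mem_FP concatFn_mem_FP (fanoutFn_mem_FP hN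
      (comp_mem_FP concatFn_mem_FP (fanoutFn_mem_FP (comp_mem_FP umulFn_mem_FP (fanoutFn_mem_FP hg hN)) hjj)))))⟩

/-- `startF`/`midF` are polynomial time. [folklore] -/
theorem startF_midF_mem_FP {unit : List Bool → List Bool} (h : unit ∈ FP) :
    startF pR pN pB unit ∈ FP ∧ midF pR pN pB unit ∈ FP := by
  obtain ⟨-, -, -, -, -, hm, h2m⟩ := params_mem_FP pR pN pB
  have hs : startF pR pN pB unit ∈ FP := comp_mem_FP umulFn_mem_FP (fanoutFn_mem_FP h h2m)
  exact ⟨hs, comp_mem_FP concatFn_mem_FP (fanoutFn_mem_FP hs hm)⟩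

/-- **`queryFn ∈ FP`.** [cite: AroraBarak2009, §1.3] -/
theorem queryFn_mem_FP : queryFn pR pN pB Pc ∈ FP := by
  obtain ⟨-, -, hhn, hhq, -, hit, -⟩ := parse_mem_FP
  obtain ⟨-, -, -, -, -, hm, -⟩ := params_mem_FP pR pN pB
  obtain ⟨hisU, -, -, hr, hi, hk, huU, huX⟩ := index_mem_FP pR pN pB
  obtain ⟨hsU, hmU⟩ := startF_midF_mem_FP pR pN pB huU
  obtain ⟨hsX, hmX⟩ := startF_midF_mem_FP pR pN pB huX
  obtain ⟨hsr, -⟩ := startF_midF_mem_FP pR pN pB hr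
  have hcnt : lenBinF ∘ umF pR pN pB ∈ FP := comp_mem_FP lenBinF_mem_FP hm
  have hbodyU : bodyUF pR pN pB ∈ FP :=
    comp_mem_FP (zipLF_mem_FP fUnifF_mem_FP le_rfl length_fUnifF_le) (fanoutFn_mem_FP OracleCompose.id_mem_FP
      (fanoutFn_mem_FP hcnt (fanoutFn_mem_FP (const_mem_FP _) (fanoutFn_mem_FP (fromF_mem_FP hsU) (fromF_mem_FP hmU)))))
  have htres : tResF pR pN pB ∈ FP :=
    comp_mem_FP sndF_mem_FP (comp_mem_FP fstF_mem_FP (comp_mem_FP nthLF_mem_FP (fanoutFn_mem_FP OracleCompose.id_mem_FP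
      (fanoutFn_mem_FP (comp_mem_FP lenBinF_mem_FP hsr) hit))))
  have hprm : prmXF pR pN pB ∈ FP :=
    fanoutFn_mem_FP hhq (fanoutFn_mem_FP hi (fanoutFn_mem_FP (comp_mem_FP lenBinF_mem_FP hk) htres))
  have hbodyX : bodyXF pR pN pB Pc ∈ FP :=
    comp_mem_FP (zipLF_mem_FP (fX_mem_FP Pc) (Nat.zero_le 2) (length_fX_le Pc)) (fanoutFn_mem_FP OracleCompose.id_mem_FP
      (fanoutFn_mem_FP hcnt (fanoutFn_mem_FP hprm (fanoutFn_mem_FP (fromF_mem_FP hsX) (fromF_mem_FP hmX)))))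
  exact fanoutFn_mem_FP hhn (fanoutFn_mem_FP hhq (fanoutFn_mem_FP hm (iteFn_mem_FP hisU hbodyU hbodyX)))

/-! #### The specification -/

section Spec

variable [NeZero q] (S : Fin ((PP pR pN pB D n).total n m) → (Fin n → ZMod q) × ZMod q) (r : List Bool)

omit [NeZero q] in
/-- The input is at least as long as the sample code. [folklore] -/
theorem length_encode_le_length_zIn (b : ℕ) : (encodeLWESamples S).length ≤ (zIn S r b).length := by
  rw [zIn, length_boolPair, length_boolPair]; omega

omit [NeZero q] in
/-- The basic lengths are dominated by the input: `m'`, `n`, `|bin q| ≤ |z|`. [folklore] -/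
theorem lengths_le_zIn (htot : 0 < (PP pR pN pB D n).total n m) (b : ℕ) :
    (PP pR pN pB D n).total n m ≤ (zIn S r b).length ∧ n ≤ (zIn S r b).length ∧ (encodeNat q).length ≤ (zIn S r b).length := by
  obtain ⟨h1, h2, h3⟩ := le_length_encodeLWESamples htot S
  have h := length_encode_le_length_zIn pR pN pB D S r b
  exact ⟨h3.trans h, h1.trans h, h2.trans h⟩

omit [NeZero q] in
/-- `fromF pos` reads the samples from position `|pos z|` on. [folklore] -/
theorem fromF_zIn {pos : List Bool → List Bool} {b p : ℕ} (hpos : pos (zIn S r b) = ones p) (hp : p ≤ (zIn S r b).length) :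
    fromF pos (zIn S r b) = encList ((sampleList S).drop p) := by
  rw [fromF, Function.comp_apply, fanoutFn_apply, fanoutFn_apply, Function.comp_apply, id, hpos, lenBinF_apply,
    List.length_replicate, itemsF_zIn, lweBlockCode_eq, dropLF_apply _ hp]

omit [NeZero q] in
/-- `startF` and `midF` on a unit selector with value `1ᵘ`. [folklore] -/
theorem startF_midF_zIn (htot : 0 < (PP pR pN pB D n).total n m) {unit : List Bool → List Bool} {b u : ℕ}
    (hu : unit (zIn S r b) = ones u) :
    startF pR pN pB unit (zIn S r b) = ones (u * (m + m)) ∧ midF pR pN pB unit (zIn S r b) = ones (u * (m + m) + m) := by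
  have hs : startF pR pN pB unit (zIn S r b) = ones (u * (m + m)) := by
    rw [startF, Function.comp_apply, umulFn_apply, fanoutFn_apply, fstF_boolPair, sndF_boolPair, hu, u2mF_zIn pR pN pB D S r b htot,
      List.length_replicate, List.length_replicate]
  exact ⟨hs, by rw [midF, Function.comp_apply, fanoutFn_apply, hs, umF_zIn pR pN pB D S r b htot, concatFn_boolPair, Com.ones_append]⟩

omit [NeZero q] in
/-- The first half of unit `u`, as the first `m` sample codes from position `u·2m` on. [folklore] -/
theorem take_drop_sampleList_first (u : Fin ((PP pR pN pB D n).K n)) :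
    ((sampleList S).drop (u.val * (m + m))).take m =
      List.ofFn fun p : Fin m => lweSampleCode (Params.units S u (Fin.castAdd m p)) := by
  have hu : u.val * (m + m) + (m + m) ≤ (PP pR pN pB D n).total n m := by
    show u.val * (m + m) + (m + m) ≤ (PP pR pN pB D n).K n * (m + m)
    have := u.isLt; nlinarith
  apply List.ext_getElem
  · simp only [List.length_take, List.length_drop, length_sampleList, List.length_ofFn]; omega
  · intro p h1 h2
    rw [List.length_ofFn] at h2
    rw [List.getElem_take, List.getElem_drop, getElem_sampleList, List.getElem_ofFn]
    congr 1
    show S _ = S (finProdFinEquiv (u, Fin.castAdd m ⟨p, h2⟩))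
    congr 1
    exact Fin.ext (by rw [val_finProdFinEquiv]; rfl)

omit [NeZero q] in
/-- The second half of unit `u`, as the first `m` sample codes from position `u·2m + m` on. [folklore] -/
theorem take_drop_sampleList_second (u : Fin ((PP pR pN pB D n).K n)) :
    ((sampleList S).drop (u.val * (m + m) + m)).take m =
      List.ofFn fun p : Fin m => lweSampleCode (Params.units S u (Fin.natAdd m p)) := by
  have hu : u.val * (m + m) + (m + m) ≤ (PP pR pN pB D n).total n m := by
    show u.val * (m + m) + (m + m) ≤ (PP pR pN pB D n).K n * (m + m)
    have := u.isLt; nlinarith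
  apply List.ext_getElem
  · simp only [List.length_take, List.length_drop, length_sampleList, List.length_ofFn]; omega
  · intro p h1 h2
    rw [List.length_ofFn] at h2
    rw [List.getElem_take, List.getElem_drop, getElem_sampleList, List.getElem_ofFn]
    congr 1
    show S _ = S (finProdFinEquiv (u, Fin.natAdd m ⟨p, h2⟩))
    congr 1
    exact Fin.ext (by simp only [val_finProdFinEquiv, Fin.val_natAdd]; omega)

omit [NeZero q] in
/-- Zipping an item function over two `ofFn` lists (twin of `zipImages_ofFn` of
`Algebra/EuclideanLattices/LLLMachineTables.lean`, which is not in this file's import closure). [folklore] -/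
theorem zipImages_ofFn (f : List Bool → List Bool) (x prm : List Bool) {k : ℕ} (F G : Fin k → List Bool) :
    zipImages f x prm (List.ofFn F) (List.ofFn G) = List.ofFn fun p => f (boolPair x (boolPair prm (boolPair (F p) (G p)))) := by
  apply List.ext_getElem
  · simp [zipImages]
  · intro p h1 h2
    simp [zipImages]

omit [NeZero q] in
/-- **Uniform queries**: for `b < N` the body is the code of the uniform block `ublk S b`.
[cite: RegevLWE2009, §4 (proof of Lemma 4.1)] -/
theorem bodyUF_zIn (htot : 0 < (PP pR pN pB D n).total n m) (j : Fin (pN.eval n)) :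
    bodyUF pR pN pB (zIn S r j.val) = lweBlockCode (Params.units S ((PP pR pN pB D n).uUnit n j) |> ublkOf) := by
  obtain ⟨hle, -, -⟩ := lengths_le_zIn pR pN pB D S r htot j.val
  set u : Fin ((PP pR pN pB D n).K n) := (PP pR pN pB D n).uUnit n j with hudef
  have huval : u.val = pR.eval n + j.val := rfl
  have hunit : unitUF pR (zIn S r j.val) = ones u.val := by rw [unitUF_zIn pR pN pB D S r _ htot, huval]
  obtain ⟨hs, hmid⟩ := startF_midF_zIn pR pN pB D S r htot hunit
  have hub : u.val * (m + m) + (m + m) ≤ (PP pR pN pB D n).total n m := by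
    show u.val * (m + m) + (m + m) ≤ (PP pR pN pB D n).K n * (m + m)
    have := u.isLt; nlinarith
  have hm_le : m ≤ (zIn S r j.val).length := by nlinarith
  rw [bodyUF, Function.comp_apply]
  simp only [fanoutFn_apply, Function.comp_apply, id]
  rw [umF_zIn pR pN pB D S r _ htot, lenBinF_apply, List.length_replicate, l1UF, l2UF,
    fromF_zIn pR pN pB D S r hs (by omega), fromF_zIn pR pN pB D S r hmid (by omega), zipLF_apply fUnifF _ [] hm_le,
    take_drop_sampleList_first pR pN pB D S u, take_drop_sampleList_second pR pN pB D S u, zipImages_ofFn, lweBlockCode]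
  refine congrArg encList (congrArg List.ofFn (funext fun p => ?_))
  rw [fUnifF_codes]
  rfl

omit [NeZero q] in
/-- The shift-vector field of a test query: the residue code of `t_r`. [folklore] -/
theorem tResF_zIn_x (htot : 0 < (PP pR pN pB D n).total n m) (i : Fin n) (k : Fin (pB.eval n)) (r' : Fin (pR.eval n))
    (j : Fin (pN.eval n)) :
    tResF pR pN pB (zIn S r ((PP pR pN pB D n).xIdx ((PP pR pN pB D n).gOf i k r').val j.val)) =
      lweResidueCode (Params.tVec S r') := by
  set b := (PP pR pN pB D n).xIdx ((PP pR pN pB D n).gOf i k r').val j.val with hb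
  obtain ⟨hle, -, -⟩ := lengths_le_zIn pR pN pB D S r htot b
  obtain ⟨hr, -, -⟩ := ikrF_zIn_x pR pN pB D S r htot i k r' j
  obtain ⟨hs, -⟩ := startF_midF_zIn pR pN pB D S r htot hr
  have hK : r'.val < (PP pR pN pB D n).K n := by
    show r'.val < (PP pR pN pB D n).R + _; simp only [PP_R]; omega
  have hpos : r'.val * (m + m) < (PP pR pN pB D n).total n m := by
    obtain ⟨-, hmpos⟩ := pos_of_total_pos htot
    show r'.val * (m + m) < (PP pR pN pB D n).K n * (m + m)
    nlinarith
  have hnth := nthLF_apply (zIn S r b) (k := r'.val * (m + m)) (by omega) (sampleList S)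
  rw [tResF, Function.comp_apply, Function.comp_apply, Function.comp_apply, fanoutFn_apply, fanoutFn_apply,
    Function.comp_apply, id, hs, lenBinF_apply, List.length_replicate, itemsF_zIn, lweBlockCode_eq, hnth,
    List.getD_eq_getElem _ _ (by simpa using hpos), getElem_sampleList, sndF_fstF_lweSampleCode]
  have hmm : 0 < m + m := by obtain ⟨-, hmpos⟩ := pos_of_total_pos htot; omega
  refine congrArg lweResidueCode ?_
  rw [Params.tVec, tOf_eq hmm]
  exact congrArg (fun idx => (S idx).1)
    (Fin.ext (by rw [val_finProdFinEquiv]; rfl) : _ = finProdFinEquiv ((PP pR pN pB D n).tUnit n r', (⟨0, hmm⟩ : Fin (m + m))))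

omit [NeZero q] in
/-- The clip of the test item function never bites on intended inputs: `sampleCodeBound n q ≤ 9(|z|+1)²`.
[folklore] -/
theorem sampleCodeBound_le (htot : 0 < (PP pR pN pB D n).total n m) (b : ℕ) :
    sampleCodeBound n q ≤ (9 * (X + 1) ^ 2 : Polynomial ℕ).eval (zIn S r b).length := by
  obtain ⟨-, hn, hq⟩ := lengths_le_zIn pR pN pB D S r htot b
  simp only [eval_mul, eval_ofNat, eval_pow, eval_add, eval_X, eval_one, sampleCodeBound]
  nlinarith

/-- **Test queries**: for `b = N + (g·N + j)`, `g = (i, k, r)`, the body (with clip `9(X+1)²`) is the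
code of the test block `xblk S g j`. [cite: RegevLWE2009, §4 (proofs of Lemmas 4.1–4.2)] -/
theorem bodyXF_zIn (htot : 0 < (PP pR pN pB D n).total n m) (i : Fin n) (k : Fin (pB.eval n)) (r' : Fin (pR.eval n))
    (j : Fin (pN.eval n)) :
    bodyXF pR pN pB (9 * (X + 1) ^ 2) (zIn S r ((PP pR pN pB D n).xIdx ((PP pR pN pB D n).gOf i k r').val j.val)) =
      lweBlockCode (Params.xblk S ((PP pR pN pB D n).gOf i k r') j) := by
  set g := (PP pR pN pB D n).gOf i k r' with hg
  set b := (PP pR pN pB D n).xIdx g.val j.val with hb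
  obtain ⟨hle, hnle, -⟩ := lengths_le_zIn pR pN pB D S r htot b
  set u : Fin ((PP pR pN pB D n).K n) := (PP pR pN pB D n).xUnit g j with hudef
  have hgj := gjF_zIn_x pR pN pB D S r htot g j
  have hunit : unitXF pR pN (zIn S r b) = ones u.val := by
    rw [unitXF, Function.comp_apply]
    simp only [fanoutFn_apply, Function.comp_apply, concatFn_boolPair, umulFn_apply, fstF_boolPair, sndF_boolPair]
    rw [uRF_zIn pR pN pB D S r _ htot, uNF_zIn pR pN pB D S r _ htot, hgj.1, hgj.2, List.length_replicate, List.length_replicate,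
      Com.ones_append, Com.ones_append, Com.ones_append, hudef, Params.val_xUnit]
    rfl
  obtain ⟨hs, hmid⟩ := startF_midF_zIn pR pN pB D S r htot hunit
  have hub : u.val * (m + m) + (m + m) ≤ (PP pR pN pB D n).total n m := by
    show u.val * (m + m) + (m + m) ≤ (PP pR pN pB D n).K n * (m + m)
    have := u.isLt; nlinarith
  have hm_le : m ≤ (zIn S r b).length := by nlinarith
  obtain ⟨-, hi, hk⟩ := ikrF_zIn_x pR pN pB D S r htot i k r' j
  have hprm : prmXF pR pN pB (zIn S r b) =
      boolPair (encodeNat q) (boolPair (ones i.val) (boolPair (encodeNat k.val) (lweResidueCode (Params.tVec S r')))) := by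
    rw [prmXF]
    simp only [fanoutFn_apply, Function.comp_apply]
    rw [hqF_zIn, hi, hk, lenBinF_apply, List.length_replicate, tResF_zIn_x pR pN pB D S r htot]
  rw [bodyXF, Function.comp_apply]
  simp only [fanoutFn_apply, Function.comp_apply, id]
  rw [umF_zIn pR pN pB D S r _ htot, lenBinF_apply, List.length_replicate, l1XF, l2XF,
    fromF_zIn pR pN pB D S r hs (by omega), fromF_zIn pR pN pB D S r hmid (by omega), hprm, zipLF_apply (fX _) _ _ hm_le,
    take_drop_sampleList_first pR pN pB D S u, take_drop_sampleList_second pR pN pB D S u, zipImages_ofFn, lweBlockCode]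
  refine congrArg encList (congrArg List.ofFn (funext fun p => ?_))
  have hw := fX_wX (9 * (X + 1) ^ 2) (zIn S r b) i k.val (Params.tVec S r') (Params.units S u (Fin.castAdd m p))
    (Params.units S u (Fin.natAdd m p)) hnle (sampleCodeBound_le pR pN pB D S r htot b)
  rw [wX] at hw
  rw [hw, Params.xblk, Params.ikr_gOf]
  rfl

omit [NeZero q] in
/-- **Specification of the query generator, uniform queries** (`b < N`). [cite: RegevLWE2009, §4 Lemma 4.1–4.2] -/
theorem queryFn_zIn_lt (htot : 0 < (PP pR pN pB D n).total n m) (j : Fin (pN.eval n)) :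
    queryFn pR pN pB (9 * (X + 1) ^ 2) (zIn S r j.val) = encodeLWESamples (Params.qry S j.val) := by
  rw [queryFn]
  simp only [fanoutFn_apply]
  rw [hnF_zIn, hqF_zIn, umF_zIn pR pN pB D S r _ htot, iteFn_apply_true (by rw [isUF_zIn pR pN pB D S r _ htot]; simp [j.isLt]),
    bodyUF_zIn pR pN pB D S r htot j, encodeLWESamples_eq, Params.qry_lt S j]
  rfl

/-- **Specification of the query generator, test queries** (`b = N + (g·N + j)`). [cite: RegevLWE2009, §4 Lemma 4.1–4.2] -/
theorem queryFn_zIn_xIdx (htot : 0 < (PP pR pN pB D n).total n m) (i : Fin n) (k : Fin (pB.eval n)) (r' : Fin (pR.eval n))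
    (j : Fin (pN.eval n)) :
    queryFn pR pN pB (9 * (X + 1) ^ 2) (zIn S r ((PP pR pN pB D n).xIdx ((PP pR pN pB D n).gOf i k r').val j.val)) =
      encodeLWESamples (Params.qry S ((PP pR pN pB D n).xIdx ((PP pR pN pB D n).gOf i k r').val j.val)) := by
  have hNle : ¬ (PP pR pN pB D n).xIdx ((PP pR pN pB D n).gOf i k r').val j.val < pN.eval n := by
    unfold Params.xIdx; simp only [PP_N]; omega
  rw [queryFn]
  simp only [fanoutFn_apply]
  rw [hnF_zIn, hqF_zIn, umF_zIn pR pN pB D S r _ htot, iteFn_apply_false (by rw [isUF_zIn pR pN pB D S r _ htot]; simp [hNle]),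
    bodyXF_zIn pR pN pB D S r htot, encodeLWESamples_eq, Params.qry_xIdx S ((PP pR pN pB D n).gOf i k r') j]

/-- **Specification of the query generator**: on `⟨⟨encodeLWESamples S, r⟩, 1ᵇ⟩`, for every query index
`b < N + G·N` of a nonempty input, the output is the code of the `b`-th query of the reduction.
[cite: RegevLWE2009, §4 Lemma 4.1–4.2] -/
theorem queryFn_spec (htot : 0 < (PP pR pN pB D n).total n m) {b : ℕ} (hb : b < (PP pR pN pB D n).numQueries n) :
    queryFn pR pN pB (9 * (X + 1) ^ 2) (zIn S r b) = encodeLWESamples (Params.qry S b) := by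
  by_cases hbN : b < pN.eval n
  · exact queryFn_zIn_lt pR pN pB D S r htot ⟨b, hbN⟩
  · have hNpos : 0 < pN.eval n := by
      unfold Params.numQueries at hb; simp only [PP_N] at hb
      rcases Nat.eq_zero_or_pos (pN.eval n) with h | h
      · rw [h] at hb; simp at hb
      · exact h
    have hlt : b - pN.eval n < (PP pR pN pB D n).groups n * pN.eval n := by
      unfold Params.numQueries at hb; simp only [PP_N] at hb; omega
    set x : Fin ((PP pR pN pB D n).groups n) × Fin (pN.eval n) := finProdFinEquiv.symm ⟨b - pN.eval n, hlt⟩ with hx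
    have hfx : (finProdFinEquiv x : Fin ((PP pR pN pB D n).groups n * pN.eval n)) = ⟨b - pN.eval n, hlt⟩ := by
      rw [hx, Equiv.apply_symm_apply]
    have h1 : x.1.val * pN.eval n + x.2.val = b - pN.eval n := by
      have := val_finProdFinEquiv ((PP pR pN pB D n).groups n) (pN.eval n) x.1 x.2
      rw [Prod.mk.eta, hfx] at this
      exact this.symm
    have hbeq : b = (PP pR pN pB D n).xIdx x.1.val x.2.val := by
      unfold Params.xIdx; simp only [PP_N]; omega
    have hg := (PP pR pN pB D n).gOf_ikr x.1
    rw [hbeq, ← hg]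
    exact queryFn_zIn_xIdx pR pN pB D S r htot _ _ _ _

end Spec

end Query

end DecisionToSearch

end LWE

end Literature.Computability.Cryptography

end
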